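/-
Copyright (c) 2026 the pub-hodgecm-mathlib formalisation cell (harness21).  Prover seat hodgecm-mathlib-F0P2-p09 (g0), re-dealt to L1
`stub_firstTermThetaPairing` (director s1969∕s1970); hLiu418 = `stmt-HodgeConjecture-24832`; I4-conv (F′-fact): the place-`w` readings of the F-files' transport pins.
-/
import Summits.HodgeConjecture.HodgeConjecture.Theorems.K2LiuKlingenInnerSectionLocalDefs    -- ★ B: `psiLoc`, `psiLoc_apply`, `evalPlace_finPart_eq_evalAt` (+ ★ `UnitaryGroupPlaceInclusion`)
import Literature.NumberTheory.Automorphic.GL2EllipticSplitPlaceLocal                       -- ★ `AdelicGroupData.adeleEval_algebraMap`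
import HarnessLib

/-!
# Crux `HLiu418`, I4-conv (F′-fact) — `K2LiuKlingenTransportPlaceReading`: THE PLACE-`w` READINGS OF THE TRANSPORT PINS `hΨ`, `hSA`, `hSAi`, `ha`
# (`(Ψ_v z)_w = S_w · z_w · S_w⁻¹`, `S_w = (1 X_w; 1 −X_w)`, `S_w⁻¹ = (a_w a_w; Y_w −Y_w)`, `a_w + a_w = 1`) — the frame binders of ★ `K2LiuKlingenInnerSectionLocalCharacter`

Cell `hodgecm-mathlib`, crux item hLiu418 = `stmt-HodgeConjecture-24832`; squad K2 ∕ K2Liu (re-dealt hand F0P2-p09 (g0)); LEAD F0P6-plan (g14); named by desk K2Liu-p14 (g3)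
(16:22:12Z: «the LAST non-★ letter of the hlaw∕hK chain»).  THEOREMS ONLY (no `def`, no instance, no notation, no named-fact hypothesis, no `sorry`); lane
`--supports stmt-HodgeConjecture-24832 --as helper`.

★ `K2LiuKlingenInnerSectionLocalCharacter` (F0P2-p10: the `cΔ`∕`hfU` dischargers `lambdaLoc_psiv_levi_mul`, `lambdaLoc_psiv_uPlus_mul`, `siegelCharLoc_psiv_weylXi_conj_klingenLevi`)
takes the local transport `Ψ_v` and its frame BY VALUE: `(SAw : ∀ w, GL (Fin 4) L_w) (Xw Yw) (aw) (haw : aw w + aw w = 1) (hSAw : reindex e₂⁻¹ e₂⁻¹ ↑(SAw w) = fromBlocks 1 (Xw w) 1 (−Xw w))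
(hSAwi : … ↑(SAw w)⁻¹ = fromBlocks (aw w • 1) (aw w • 1) (Yw w) (−Yw w)) (hΨv : ∀ z w, ((Ψ_v z)_w : Matrix) = ↑(SAw w) · z_w · ↑(SAw w)⁻¹)`.  The F-files (★ carrier (A)
`K2LiuKlingenTermTwoTransport` §4) pin the GLOBAL transport: `hΨ : ((Ψ g) : Matrix) = S_𝔸 · adelicVal g · S_𝔸⁻¹`, `hSA : reindex ↑S_𝔸 = fromBlocks 1 (X ⊗ 1) 1 (−X ⊗ 1)`,
`hSAi : reindex ↑S_𝔸⁻¹ = fromBlocks (a ⊗ 1) (a ⊗ 1) (Y ⊗ 1) (−Y ⊗ 1)` (`X, Y ∈ M₂(L⁺)`, `a ∈ L⁺`, `· ⊗ 1 = map (algebraMap L 𝔸_L ∘ algebraMap L⁺ L)`), `ha : a + a = 1`.  THIS FILE reads them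
at a place: with `Ψ_v := psiLoc Ψ v` (★ B), `S_w := GLn.evalAt _ L w (GLn.sndHom _ L S_𝔸)`, `X_w := X.map ι_w`, `Y_w := Y.map ι_w`, `a_w := ι_w a` (`ι_w = algebraMap L L_w ∘ algebraMap L⁺ L`):
* (PR1) **`coe_psiLoc_apply_eq_conj`** — `hΨv` from `hΨ` (generic `N`, `J`, `J′`; ★ B `psiLoc_apply` ∕ `evalPlace_finPart_eq_evalAt`, ★ `evalPlace_finPart_inclPlaceAdelic`);
* (PR2) **`reindex_evalAt_sndHom_eq_fromBlocks`** — `hSAw` from `hSA`; (PR3) **`reindex_evalAt_sndHom_inv_eq_fromBlocks`** — `hSAwi` from `hSAi` (the `w`-block of the finite part is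
  `Matrix.map` along `𝔸_L → L_w`, which sends `algebraMap L 𝔸_L x` to `algebraMap L L_w x`: ★ `AdelicGroupData.adeleEval_algebraMap`);
* (PR4) **`algebraMap_add_self_eq_one`** — `haw` from `ha`.
So ★ E feeds ★ C's `hlaw` BY NAME: `hlaw_of_upper_mul (hJ := ★ innerSectionLoc_upper_mul_units … (lambdaLoc_psiv_levi_mul … PR1–PR4 …) (lambdaLoc_psiv_uPlus_mul …)) (hcΔ := siegelCharLoc_… PR …)`.
[BorelJacquet1979, §4.1], [PlatonovRapinchuk1994, §5.1], [CasselsFrohlichANT1967, Ch. II §14].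
HONEST LABEL.  Count-neutral helper: `HC_CM` is proved only modulo the 7 printed citations (2 remaining named inputs: hLiu418 = `stmt-HodgeConjecture-24832`,
h413 = `stmt-HodgeConjecture-24833`) until rung 0 closes; this file closes no socket by itself.

## Mathlib ∕ tree search
Tree ★: B `psiLoc_apply`, `evalPlace_finPart_eq_evalAt`; `UnitaryGroup.evalPlace_finPart_inclPlaceAdelic`; `GLn.evalAt`, `GLn.sndHom` (`GeneralLinearGroup.map`); `AdelicGroupData.adeleEval_algebraMap`.
Mathlib: `Matrix.GeneralLinearGroup.map_apply`, `Matrix.submatrix_map`, `Matrix.fromBlocks_map`, `Matrix.map_map`.  Dedup: `rg "coe_psiLoc_apply_eq_conj|reindex_evalAt_sndHom" Summits/` — none.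
-/

set_option autoImplicit false
set_option linter.dupNamespace false -- the mandated namespace repeats `HodgeConjecture.HodgeConjecture`

noncomputable section

open scoped Matrix
open NumberField IsDedekindDomain

namespace Summit.HodgeConjecture.HodgeConjecture.Cruxes.HLiu418.K2LiuKlingenTransportPlaceReading

open Literature.NumberTheory.Automorphic Literature.NumberTheory.Automorphic.UnitaryGroup
open Literature.NumberTheory.GelbartRogawski1991 Literature.NumberTheory.GelbartRogawski1991.GRConstruction
open Summit.HodgeConjecture.HodgeConjecture.Cruxes.HLiu418.K2LiuKlingenInnerSectionLocalDefs

variable (L : Type) [Field L] [NumberField L] [IsCMField L] (v : HeightOneSpectrum (𝓞 (Fp L)))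

/-! ## (PR1) `(Ψ_v z)_w = S_w · z_w · S_w⁻¹` -/

/-- **(PR1) the `w`-matrix of `psiLoc Ψ v z` is `S_w · z_w · S_w⁻¹`**, `S_w = GLn.evalAt _ L w (GLn.sndHom _ L S_𝔸)`, whenever `Ψ` is conjugation by `S_𝔸` on adelic matrices
(`hΨ`, the F-files' pin; generic `N`, `J`, `J′`) — the binder `hΨv` of ★ `K2LiuKlingenInnerSectionLocalCharacter`. [cite: BorelJacquet1979, §4.1] [cite: PlatonovRapinchuk1994, §5.1] -/
theorem coe_psiLoc_apply_eq_conj {N : ℕ} {J J' : Matrix (Fin N) (Fin N) L}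
    (Ψ : (adelicGroupData (Fp L) L (IsCMField.complexConj L) N J).Adelic →* (adelicGroupData (Fp L) L (IsCMField.complexConj L) N J').Adelic)
    (SA : GL (Fin N) (AdeleRing (𝓞 L) L))
    (hΨ : ∀ g : (adelicGroupData (Fp L) L (IsCMField.complexConj L) N J).Adelic,
      (((Ψ g).1 : GL (Fin N) (AdeleRing (𝓞 L) L)) : Matrix (Fin N) (Fin N) (AdeleRing (𝓞 L) L)) =
        (SA : Matrix (Fin N) (Fin N) (AdeleRing (𝓞 L) L)) *
          ((adelicVal (Fp L) L (IsCMField.complexConj L) N J g : GL (Fin N) (AdeleRing (𝓞 L) L)) : Matrix (Fin N) (Fin N) (AdeleRing (𝓞 L) L)) *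
          ((SA⁻¹ : GL (Fin N) (AdeleRing (𝓞 L) L)) : Matrix (Fin N) (Fin N) (AdeleRing (𝓞 L) L)))
    (z : UnitaryGroup.localPi L (IsCMField.complexConj L) N J v) (w : UnitaryGroup.PlacesOver L v) :
    (((psiLoc L Ψ v z : UnitaryGroup.localPi L (IsCMField.complexConj L) N J' v) : UnitaryGroup.LocalGLPi L N v) w :
        Matrix (Fin N) (Fin N) (w.1.adicCompletion L)) =
      ((GLn.evalAt N L w.1 (GLn.sndHom N L SA) : GL (Fin N) (w.1.adicCompletion L)) : Matrix (Fin N) (Fin N) (w.1.adicCompletion L)) *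
        (((z : UnitaryGroup.LocalGLPi L N v) w : GL (Fin N) (w.1.adicCompletion L)) : Matrix (Fin N) (Fin N) (w.1.adicCompletion L)) *
        (((GLn.evalAt N L w.1 (GLn.sndHom N L SA))⁻¹ : GL (Fin N) (w.1.adicCompletion L)) : Matrix (Fin N) (Fin N) (w.1.adicCompletion L)) := by
  have hΨ' : ∀ g : (adelicGroupData (Fp L) L (IsCMField.complexConj L) N J).Adelic, ((Ψ g).1 : GL (Fin N) (AdeleRing (𝓞 L) L)) = SA * g.1 * SA⁻¹ := fun g =>
    Units.ext (by rw [hΨ g, Units.val_mul, Units.val_mul, adelicVal_apply])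
  have h1 := evalPlace_finPart_eq_evalAt L v (UnitaryGroup.inclPlaceAdelic (Fp L) L (IsCMField.complexConj L) N J v z) w
  rw [UnitaryGroup.evalPlace_finPart_inclPlaceAdelic] at h1
  have h2 : ((psiLoc L Ψ v z : UnitaryGroup.localPi L (IsCMField.complexConj L) N J' v) : UnitaryGroup.LocalGLPi L N v) w =
      GLn.evalAt N L w.1 (GLn.sndHom N L SA) * (z : UnitaryGroup.LocalGLPi L N v) w * (GLn.evalAt N L w.1 (GLn.sndHom N L SA))⁻¹ := by
    rw [psiLoc_apply, evalPlace_finPart_eq_evalAt, hΨ', map_mul, map_mul, map_inv, map_mul, map_mul, map_inv, ← h1]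
  rw [h2, Units.val_mul, Units.val_mul]

/-! ## (PR2)–(PR4) the frame at `w`: `S_w = (1 X_w; 1 −X_w)`, `S_w⁻¹ = (a_w a_w; Y_w −Y_w)`, `a_w + a_w = 1` -/

omit [IsCMField L] in
/-- the `w`-matrix of `GLn.evalAt _ L w (GLn.sndHom _ L S)` is the entrywise image of `S` under `𝔸_L → L_w` (★ `AdelicGroupData.adeleEval`). [cite: BorelJacquet1979, §4.1] -/
theorem coe_evalAt_sndHom_eq_map {N : ℕ} (S : GL (Fin N) (AdeleRing (𝓞 L) L)) (w : HeightOneSpectrum (𝓞 L)) :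
    ((GLn.evalAt N L w (GLn.sndHom N L S) : GL (Fin N) (w.adicCompletion L)) : Matrix (Fin N) (Fin N) (w.adicCompletion L)) =
      (S : Matrix (Fin N) (Fin N) (AdeleRing (𝓞 L) L)).map (AdelicGroupData.adeleEval L w) := by
  ext i j
  rfl

omit [IsCMField L] in
/-- `(x ⊗ 1)_w = x` in `L_w` for `x ∈ L⁺`: the `w`-component of the principal adele of `algebraMap L⁺ L x`. [cite: CasselsFrohlichANT1967, Ch. II §14] -/
theorem adeleEval_algebraMap_comp (w : HeightOneSpectrum (𝓞 L)) (x : Fp L) :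
    AdelicGroupData.adeleEval L w (((algebraMap L (AdeleRing (𝓞 L) L)).comp (algebraMap (Fp L) L)) x) =
      ((algebraMap L (w.adicCompletion L)).comp (algebraMap (Fp L) L)) x := by
  rw [RingHom.comp_apply, RingHom.comp_apply, AdelicGroupData.adeleEval_algebraMap]

omit [IsCMField L] in
/-- **(PR2) `S_w = (1 X_w; 1 −X_w)`** from the adelic pin `hSA` (the reindexing commutes with `Matrix.map`; `(X ⊗ 1)_w = X.map ι_w`). [cite: CasselsFrohlichANT1967, Ch. II §14] -/
theorem reindex_evalAt_sndHom_eq_fromBlocks (SA : GL (Fin (2 + 2)) (AdeleRing (𝓞 L) L)) (X : Matrix (Fin 2) (Fin 2) (Fp L))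
    (hSA : Matrix.reindex (e₂ (n := 2)).symm (e₂ (n := 2)).symm (SA : Matrix (Fin (2 + 2)) (Fin (2 + 2)) (AdeleRing (𝓞 L) L)) =
      Matrix.fromBlocks (1 : Matrix (Fin 2) (Fin 2) (AdeleRing (𝓞 L) L)) (X.map ((algebraMap L (AdeleRing (𝓞 L) L)).comp (algebraMap (Fp L) L))) 1
        (-(X.map ((algebraMap L (AdeleRing (𝓞 L) L)).comp (algebraMap (Fp L) L)))))
    (w : HeightOneSpectrum (𝓞 L)) :
    Matrix.reindex (e₂ (n := 2)).symm (e₂ (n := 2)).symm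
        ((GLn.evalAt (2 + 2) L w (GLn.sndHom (2 + 2) L SA) : GL (Fin (2 + 2)) (w.adicCompletion L)) : Matrix (Fin (2 + 2)) (Fin (2 + 2)) (w.adicCompletion L)) =
      Matrix.fromBlocks (1 : Matrix (Fin 2) (Fin 2) (w.adicCompletion L)) (X.map ((algebraMap L (w.adicCompletion L)).comp (algebraMap (Fp L) L))) 1
        (-(X.map ((algebraMap L (w.adicCompletion L)).comp (algebraMap (Fp L) L)))) := by
  have hre : Matrix.reindex (e₂ (n := 2)).symm (e₂ (n := 2)).symm
        ((GLn.evalAt (2 + 2) L w (GLn.sndHom (2 + 2) L SA) : GL (Fin (2 + 2)) (w.adicCompletion L)) : Matrix (Fin (2 + 2)) (Fin (2 + 2)) (w.adicCompletion L)) =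
      (Matrix.reindex (e₂ (n := 2)).symm (e₂ (n := 2)).symm (SA : Matrix (Fin (2 + 2)) (Fin (2 + 2)) (AdeleRing (𝓞 L) L))).map (AdelicGroupData.adeleEval L w) := by
    rw [coe_evalAt_sndHom_eq_map]
    rfl
  rw [hre, hSA, Matrix.fromBlocks_map]
  have hX : (X.map ((algebraMap L (AdeleRing (𝓞 L) L)).comp (algebraMap (Fp L) L))).map (AdelicGroupData.adeleEval L w) =
      X.map ((algebraMap L (w.adicCompletion L)).comp (algebraMap (Fp L) L)) := by
    rw [Matrix.map_map]
    exact Matrix.ext fun i j => adeleEval_algebraMap_comp L w (X i j)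
  have h1 : (1 : Matrix (Fin 2) (Fin 2) (AdeleRing (𝓞 L) L)).map (AdelicGroupData.adeleEval L w) = 1 :=
    Matrix.map_one _ (map_zero _) (map_one _)
  have hneg : (-(X.map ((algebraMap L (AdeleRing (𝓞 L) L)).comp (algebraMap (Fp L) L)))).map (AdelicGroupData.adeleEval L w) =
      -(X.map ((algebraMap L (w.adicCompletion L)).comp (algebraMap (Fp L) L))) := by
    rw [Matrix.map_neg _ (fun a => map_neg (AdelicGroupData.adeleEval L w) a), hX]
  rw [h1, hneg, hX]

omit [IsCMField L] in
/-- **(PR3) `S_w⁻¹ = (a_w a_w; Y_w −Y_w)`** from the adelic pin `hSAi` (`GLn.evalAt ∘ GLn.sndHom` is a group homomorphism, so `(S_w)⁻¹ = (S_𝔸⁻¹)_w`).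
[cite: CasselsFrohlichANT1967, Ch. II §14] -/
theorem reindex_evalAt_sndHom_inv_eq_fromBlocks (SA : GL (Fin (2 + 2)) (AdeleRing (𝓞 L) L)) (Y : Matrix (Fin 2) (Fin 2) (Fp L)) (a : Fp L)
    (hSAi : Matrix.reindex (e₂ (n := 2)).symm (e₂ (n := 2)).symm ((SA⁻¹ : GL (Fin (2 + 2)) (AdeleRing (𝓞 L) L)) : Matrix (Fin (2 + 2)) (Fin (2 + 2)) (AdeleRing (𝓞 L) L)) =
      Matrix.fromBlocks ((a • (1 : Matrix (Fin 2) (Fin 2) (Fp L))).map ((algebraMap L (AdeleRing (𝓞 L) L)).comp (algebraMap (Fp L) L)))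
        ((a • (1 : Matrix (Fin 2) (Fin 2) (Fp L))).map ((algebraMap L (AdeleRing (𝓞 L) L)).comp (algebraMap (Fp L) L)))
        (Y.map ((algebraMap L (AdeleRing (𝓞 L) L)).comp (algebraMap (Fp L) L)))
        (-(Y.map ((algebraMap L (AdeleRing (𝓞 L) L)).comp (algebraMap (Fp L) L)))))
    (w : HeightOneSpectrum (𝓞 L)) :
    Matrix.reindex (e₂ (n := 2)).symm (e₂ (n := 2)).symm
        (((GLn.evalAt (2 + 2) L w (GLn.sndHom (2 + 2) L SA))⁻¹ : GL (Fin (2 + 2)) (w.adicCompletion L)) : Matrix (Fin (2 + 2)) (Fin (2 + 2)) (w.adicCompletion L)) =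
      Matrix.fromBlocks ((((algebraMap L (w.adicCompletion L)).comp (algebraMap (Fp L) L)) a) • (1 : Matrix (Fin 2) (Fin 2) (w.adicCompletion L)))
        ((((algebraMap L (w.adicCompletion L)).comp (algebraMap (Fp L) L)) a) • (1 : Matrix (Fin 2) (Fin 2) (w.adicCompletion L)))
        (Y.map ((algebraMap L (w.adicCompletion L)).comp (algebraMap (Fp L) L)))
        (-(Y.map ((algebraMap L (w.adicCompletion L)).comp (algebraMap (Fp L) L)))) := by
  have hre : Matrix.reindex (e₂ (n := 2)).symm (e₂ (n := 2)).symm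
        (((GLn.evalAt (2 + 2) L w (GLn.sndHom (2 + 2) L SA))⁻¹ : GL (Fin (2 + 2)) (w.adicCompletion L)) : Matrix (Fin (2 + 2)) (Fin (2 + 2)) (w.adicCompletion L)) =
      (Matrix.reindex (e₂ (n := 2)).symm (e₂ (n := 2)).symm ((SA⁻¹ : GL (Fin (2 + 2)) (AdeleRing (𝓞 L) L)) : Matrix (Fin (2 + 2)) (Fin (2 + 2)) (AdeleRing (𝓞 L) L))).map
        (AdelicGroupData.adeleEval L w) := by
    rw [← map_inv, ← map_inv, coe_evalAt_sndHom_eq_map]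
    rfl
  have hY : (Y.map ((algebraMap L (AdeleRing (𝓞 L) L)).comp (algebraMap (Fp L) L))).map (AdelicGroupData.adeleEval L w) =
      Y.map ((algebraMap L (w.adicCompletion L)).comp (algebraMap (Fp L) L)) := by
    rw [Matrix.map_map]
    exact Matrix.ext fun i j => adeleEval_algebraMap_comp L w (Y i j)
  have ha1 : ((a • (1 : Matrix (Fin 2) (Fin 2) (Fp L))).map ((algebraMap L (AdeleRing (𝓞 L) L)).comp (algebraMap (Fp L) L))).map (AdelicGroupData.adeleEval L w) =
      (((algebraMap L (w.adicCompletion L)).comp (algebraMap (Fp L) L)) a) • (1 : Matrix (Fin 2) (Fin 2) (w.adicCompletion L)) := by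
    ext i j
    rw [Matrix.map_apply, Matrix.map_apply, Matrix.smul_apply, Matrix.smul_apply, adeleEval_algebraMap_comp, Matrix.one_apply, Matrix.one_apply,
      smul_eq_mul, smul_eq_mul, mul_ite, mul_one, mul_zero, mul_ite, mul_one, mul_zero]
    split_ifs <;> simp only [map_zero]
  have hneg : (-(Y.map ((algebraMap L (AdeleRing (𝓞 L) L)).comp (algebraMap (Fp L) L)))).map (AdelicGroupData.adeleEval L w) =
      -(Y.map ((algebraMap L (w.adicCompletion L)).comp (algebraMap (Fp L) L))) := by
    rw [Matrix.map_neg _ (fun x => map_neg (AdelicGroupData.adeleEval L w) x), hY]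
  rw [hre, hSAi, Matrix.fromBlocks_map, ha1, hY, hneg]

omit [IsCMField L] in
/-- **(PR4) `a_w + a_w = 1`** from `ha : a + a = 1`. [cite: CasselsFrohlichANT1967, Ch. II §14] -/
theorem algebraMap_add_self_eq_one {a : Fp L} (ha : a + a = 1) (w : HeightOneSpectrum (𝓞 L)) :
    ((algebraMap L (w.adicCompletion L)).comp (algebraMap (Fp L) L)) a + ((algebraMap L (w.adicCompletion L)).comp (algebraMap (Fp L) L)) a = 1 := by
  rw [← map_add, ha, map_one]

end Summit.HodgeConjecture.HodgeConjecture.Cruxes.HLiu418.K2LiuKlingenTransportPlaceReading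

end
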